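import Summits.QuantumFields.BalabanUV.T4Continuum.Support.VariationalVectorAvgGProjG
import Summits.QuantumFields.BalabanUV.T4Continuum.Support.VariationalVectorDivAvgCovariantSum
import Summits.QuantumFields.BalabanUV.T4Continuum.Support.VariationalColourTowerEndLocal

/-!
# T⁴ programme, spine node NE2 (U1a), lane P2 — «V-AVG-G», file 9: (G″) FOR BAŁABAN's PROJECTED GAUGE FUNCTIONAL FROM DATA ALONE — every scalar class of
# file 5 discharged by the colour road's frame-free class lemmas, DIV-AVG by file 8; what is displayed is POINTWISE OPERATOR DATA only (model level; cell `pub-balaban`)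

NE2 formalisation swarm `b2b-balaban-t4-ne2-formalise-*`, leaf prover 10 GEN 4 (`prover-b2b-balaban-t4-ne2-formalise-leaf-10-g4-0`, V-END holder lineage); item
«V-AVG-G» (CLAIMS.log 2026-08-20 l.19093 ∕ l.20240), file 9.  Composition BY NAME of file 5 (`avgG_projG_of_divAvg`, p233066), file 8 (`divAvg_cov`), and the
colour road's class lemmas EXACTLY as `VariationalColourTowerEndLocal.colour_pair_closed_local` (leaf-03-g5) uses them: `hUBc_colour_rel` (UB⁺ relative to a
unitary reference), `qWv_le_coarse_rel` ∕ `qVv_le_composite_rel` (P⁺, `C_P = 136`), `hREG_rhov` (REG⁺), `blockSpin_Q1v_le` (ONE⁺) +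
`fine_ub_of_coarse_sqrt` (fine UB⁺); nothing defined.

THE STATEMENT (`avgG_projG_of_data`).  DATA at level `n` and one step up (block side `L`), finite-dimensional Hilbert space `E`: UNITARY coarse bonds `Rc`
(plaquette defect `a`), UNITARY scalar site transports `T` with a UNITARY reference `T₀` (in-block defect `w₀`, relative size `γ < 1`, smallness, fictitious `w′`),
UNITARY one-step site transports `T′` and UNITARY fine bonds `R′` (in-block defect `w₁`, smallness), FED⁺'s site mismatch `‖misv Rc R′ T′ y μ j‖ ≤ m`
(`64d(nm)² ≤ ½`), ONE⁺'s in-block ∕ crossing defects `m₁`.  THEN for every fine 1-form `g`, with the PRODUCT line carriers `lineT T′ R′` for the vector block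
average and the NESTED scalar kernels `K = ker Q_T`, `K′ = ker(Q_T ∘ Q_{T′})`:
`(n^d)⁻¹(n²·G_K(Q_{lineT T′ R′} g)) ≤ ( √(((nL)^d)⁻¹((nL)²·G′_{K′}(g))) + (ε_D + √(136·e_H))·√(ρ_D + ((nL)^d)⁻¹((nL)²·divSq R′ g)) )²`,
`ε_D = √(3d)·(2n⁻¹ + m + n·m)`, `ρ_D = ((nL)⁴∕(nL)^d)·hessV R′ g + ((nL)²∕(nL)^d)·Σ_μΣ_x‖(D_μg_μ)(x)‖² + qVV g`, `e_H = ePV Λ 136 C_R ε₁ δ′ + eV Λ 136 δ` at the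
pair's explicit `Λ, C_R, ε₁ = (d∕4+½)L∕n², δ′ = √(2d(1+d²))·(nLm₁), δ = √d·(nm)` (the `let` telescope below = `colour_pair_closed_local`'s, verbatim).
So the (G″) socket `hAVGG` of the vector END `VariationalVectorEndOfLeavesAvgG.towerLimitRate_effV_of_leaves_avgG` (p232272) holds AT EVERY PAIR `(Q_T g, g)` from
operator data alone, with `ε″ = ε_D + √(136·e_H)` and `ρ′ = ρ_D + DIVSQ♯` — in the road's plaquette class (`n²a, n·w′, n²m, n²m₁, L∕n²` small ∕ summable) `ε″_k → 0`
geometrically; the END's `hREGf` then asks V-REG for `ρ′` at fine minimisers (`rhoV`, diagonal gradient, `qVV`, `divSq` — the classes' currency).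

HONEST FRAMING (T4-DAG p. 1).  Model level (c5 — transports DATA, product carriers; no identification with Bałaban's `R_k(U)`); composition of landed lemmas, no new
analysis; nothing printed is a hypothesis; no `def`, no `def … : Prop`, no `sorry`; axioms standard.  NOT an END statement (no minimisers, no tower); V-REG of `ρ′`
and (ONE-min) with background stay the END's displayed binders; V-END with background ∕ NE2 NOT proved; NE3 OPEN; spine PROVED 0∕9 unchanged; rung (B)+1 on a fixed
finite T⁴ — NOT infinite volume, NOT mass gap, NOT Clay.  HONEST DEPENDENCY (cell, verbatim): continuum YM on T⁴ ⇐ BetaPertH ∧ nine spine estimates (0/9 proved);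
BetaPertH ⇐ (D1) ∧ (D4) ∧ CAP+tail; G-an2-4 gates asym, D1 and NE2/3/4.
-/

noncomputable section

namespace Summit.QuantumFields.BalabanUV.T4Continuum.VariationalVectorAvgGProjGData

open Finset WithLp
open Literature.MathematicalPhysics.QuantumFieldTheory.Balaban1983to89.B5Prop11Plancherel (Tor fine unitVec)
open Literature.MathematicalPhysics.QuantumFieldTheory.Balaban1983to89.B5Block118 (bpt)
open Literature.MathematicalPhysics.QuantumFieldTheory.Balaban1983to89.B5Blocks16 (blockOf)
open Summit.QuantumFields.BalabanUV.T4Continuum.VariationalTransfer (blockSpin)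
open Summit.QuantumFields.BalabanUV.T4Continuum.VariationalColourFederbush (misv Qcv norm_le_one_of_mem_unitary)
open Summit.QuantumFields.BalabanUV.T4Continuum.VariationalColourUpperBound (nsqv nsqv_nonneg)
open Summit.QuantumFields.BalabanUV.T4Continuum.VariationalColourScalarPair
  (Scv Sfv qWv qVv Qkv Q1v Scv_nonneg Sfv_nonneg qWv_nonneg qVv_nonneg norm_sq_le_qWv norm_sq_le_qVv continuous_Qcv continuous_sum_dirUv Q1v_surjective)
open Summit.QuantumFields.BalabanUV.T4Continuum.VariationalColourPoincarePhys (qWv_le_coarse_rel qVv_le_composite_rel)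
open Summit.QuantumFields.BalabanUV.T4Continuum.VariationalColourOneStepPhys (rhov rhov_nonneg blockSpin_Q1v_le)
open Summit.QuantumFields.BalabanUV.T4Continuum.VariationalColourRegularityRho (hREG_rhov)
open Summit.QuantumFields.BalabanUV.T4Continuum.VariationalCovariantUpperSqrt (fine_ub_of_coarse_sqrt)
open Summit.QuantumFields.BalabanUV.T4Continuum.VariationalColourTowerEndLocal (hUBc_colour_rel)
open Summit.QuantumFields.BalabanUV.T4Continuum.VariationalVectorEndOfLeaves (eV ePV)
open Summit.QuantumFields.BalabanUV.T4Continuum.VariationalVectorOneStep (hessV)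
open Summit.QuantumFields.BalabanUV.T4Continuum.VectorBlockTrialForm (QvL)
open Summit.QuantumFields.BalabanUV.T4Continuum.VariationalVectorForm (cdV qVV qVV_nonneg)
open Summit.QuantumFields.BalabanUV.T4Continuum.VariationalVectorFederbush (lineT)
open Summit.QuantumFields.BalabanUV.T4Continuum.VariationalVectorWeitzenbock (divSq)
open Summit.QuantumFields.BalabanUV.T4Continuum.VariationalVectorGaugeSlice (projG avgOp)
open Summit.QuantumFields.BalabanUV.T4Continuum.VariationalColourInterpolant (hessv_nonneg)
open Summit.QuantumFields.BalabanUV.T4Continuum.VariationalVectorAvgGProjG (avgG_projG_of_divAvg)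
open Summit.QuantumFields.BalabanUV.T4Continuum.VariationalVectorDivAvgCovariantSum (divAvg_cov)

variable {d : ℕ} {E : Type*} [NormedAddCommGroup E] [InnerProductSpace ℂ E] [CompleteSpace E] [FiniteDimensional ℂ E]
variable (n L : ℕ) [NeZero n] [NeZero L] (M : Fin d → ℕ) [hM : ∀ μ, NeZero (M μ)]

/-- **(G″) FOR BAŁABAN's PROJECTED GAUGE FUNCTIONAL FROM OPERATOR DATA ALONE** (nested scalar kernels, product line carriers `lineT T′ R′`; the scalar classes
of `avgG_projG_of_divAvg` discharged by the colour road's frame-free class lemmas at `colour_pair_closed_local`'s constants, DIV-AVG by `divAvg_cov`):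
`(n^d)⁻¹(n²·G_{ker Q_T}(Q_{lineT T′ R′} g)) ≤ (√(((nL)^d)⁻¹((nL)²·G′_{ker(Q_T∘Q_{T′})}(g))) + (ε_D + √(136·e_H))·√(ρ_D + ((nL)^d)⁻¹((nL)²·divSq R′ g)))²`,
`ε_D = √(3d)·(2n⁻¹ + m + n·m)`. [folklore] -/
theorem avgG_projG_of_data {Rc : Tor (fine n M) → Fin d → (E →L[ℂ] E)} {R' : Tor (fine L (fine n M)) → Fin d → (E →L[ℂ] E)}
    {T T₀ : Tor (fine n M) → (E →L[ℂ] E)} {T' : Tor (fine L (fine n M)) → (E →L[ℂ] E)}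
    -- level-n data: UNITARY site transports and bonds, plaquette defect `a`
    (hT : ∀ x, T x ∈ unitary (E →L[ℂ] E)) (hRc : ∀ x μ, Rc x μ ∈ unitary (E →L[ℂ] E))
    {a : ℝ} (ha : 0 ≤ a)
    (hP : ∀ x μ ν, ‖Rc x μ * Rc (x + unitVec (fine n M) μ) ν - Rc x ν * Rc (x + unitVec (fine n M) ν) μ‖ ≤ a)
    -- the reference `T₀` (unitary), in-block defect `w₀`, relative size `γ < 1`, smallness, fictitious `w′`
    (hT₀ : ∀ x, T₀ x ∈ unitary (E →L[ℂ] E)) {w₀ : ℝ} (hw0 : 0 ≤ w₀)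
    (hw₀ : ∀ (x : Tor (fine n M)) (μ : Fin d), blockOf n M (x + unitVec (fine n M) μ) = blockOf n M x →
      ‖Rc x μ * star (T₀ (x + unitVec (fine n M) μ)) * T₀ x - 1‖ ≤ w₀)
    {γ : ℝ} (hγ : γ < 1) (hrel : ∀ x, ‖T x * star (T₀ x) - 1‖ ≤ γ)
    (hsmall : 2 * (d : ℝ) * ((n : ℝ) * w₀) ^ 2 + 4 * γ ^ 2 ≤ 1 / 2)
    {w' : ℝ} (hw'0 : 0 ≤ w') (hw' : (4 + n * w₀) / (1 - γ) - 1 ≤ n * w')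
    -- level-nL data: UNITARY one-step site transports and fine bonds, in-block defect `w₁`
    (hT' : ∀ x, T' x ∈ unitary (E →L[ℂ] E)) (hR' : ∀ x μ, R' x μ ∈ unitary (E →L[ℂ] E)) {w₁ : ℝ}
    (hw₁ : ∀ (x : Tor (fine L (fine n M))) (μ : Fin d), blockOf L (fine n M) (x + unitVec (fine L (fine n M)) μ) = blockOf L (fine n M) x →
      ‖R' x μ * star (T' (x + unitVec (fine L (fine n M)) μ)) * T' x - 1‖ ≤ w₁)
    (hsmall₁ : 2 * (d : ℝ) * ((L : ℝ) * w₁) ^ 2 ≤ 1 / 2)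
    -- FED⁺ data: the site mismatch `m`
    {m : ℝ} (hm : 0 ≤ m) (hmis : ∀ y μ j, ‖misv L (fine n M) Rc R' T' y μ j‖ ≤ m) (habsorb : 64 * (d : ℝ) * ((n : ℝ) * m) ^ 2 ≤ 1 / 2)
    -- ONE⁺ data: in-block ∕ crossing defects `m₁`
    {m₁ : ℝ} (hm₁ : 0 ≤ m₁)
    (hin : ∀ (y : Tor (fine n M)) (j : Fin d → Fin L) (μ : Fin d), (j μ : ℕ) + 1 < L →
      ‖R' (bpt L (fine n M) y j) μ * star (T' (bpt L (fine n M) y j + unitVec (fine L (fine n M)) μ)) - star (T' (bpt L (fine n M) y j))‖ ≤ m₁)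
    (hcross : ∀ (y : Tor (fine n M)) (j : Fin d → Fin L) (μ : Fin d), (j μ : ℕ) + 1 = L →
      ‖R' (bpt L (fine n M) y j) μ * star (T' (bpt L (fine n M) y j + unitVec (fine L (fine n M)) μ))
        - star (T' (bpt L (fine n M) y j)) * Rc y μ‖ ≤ m₁)
    (g : Tor (fine L (fine n M)) → Fin d → E) :
    let Λc : ℝ := 2 * d * (36 : ℝ) ^ d * ((1 + n * w') ^ 2 + 9)
    let CP : ℝ := 136
    let CR : ℝ := 2 * Λc + 2 * d * (a * (n : ℝ) ^ 2) + (d : ℝ) ^ 2 * (a * (n : ℝ) ^ 2) ^ 2 * CP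
    let ε₁ : ℝ := ((d : ℝ) / 4 + 1 / 2) * ((L : ℝ) / (n : ℝ) ^ 2)
    let δ' : ℝ := Real.sqrt (2 * d * (1 + (d : ℝ) ^ 2)) * ((n : ℝ) * L * m₁)
    let Λ : ℝ := Λc + (ε₁ * CR + 2 * δ' * Real.sqrt ((1 + ε₁ * CR) * CP) + δ' ^ 2 * CP) * (Λc + 1)
    let δ : ℝ := Real.sqrt d * ((n : ℝ) * m)
    let eH : ℝ := ePV Λ CP CR ε₁ δ' + eV Λ CP δ
    let εD : ℝ := Real.sqrt (3 * d) * (2 * (n : ℝ)⁻¹ + m + n * m)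
    let ρD : ℝ := (((n : ℝ) * L) ^ 4 / ((n : ℝ) * L) ^ d) * hessV (fine L (fine n M)) R' g
      + (((n : ℝ) * L) ^ 2 / ((n : ℝ) * L) ^ d) * ∑ μ : Fin d, ∑ x : Tor (fine L (fine n M)), ‖cdV (fine L (fine n M)) R' g x μ μ‖ ^ 2 + qVV n L M g
    ((n : ℝ) ^ d)⁻¹ * ((n : ℝ) ^ 2 * projG (fine n M) Rc (LinearMap.ker (avgOp n M T)) (QvL L (fine n M) (lineT L (fine n M) T' R') g))
      ≤ (Real.sqrt ((((n : ℝ) * L) ^ d)⁻¹ * (((n : ℝ) * L) ^ 2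
              * projG (fine L (fine n M)) R' (LinearMap.ker ((avgOp n M T).comp (avgOp L (fine n M) T'))) g))
          + (εD + Real.sqrt (CP * eH)) * Real.sqrt (ρD + (((n : ℝ) * L) ^ d)⁻¹ * (((n : ℝ) * L) ^ 2 * divSq (fine L (fine n M)) R' g))) ^ 2 := by
  intro Λc CP CR ε₁ δ' Λ δ eH εD ρD
  have hn0 : (0 : ℝ) < n := by exact_mod_cast Nat.pos_of_ne_zero (NeZero.ne n)
  have hL1 : (1 : ℝ) ≤ L := by exact_mod_cast Nat.one_le_iff_ne_zero.mpr (NeZero.ne L)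
  have hd : (0 : ℝ) ≤ d := Nat.cast_nonneg d
  have hΛc : 0 ≤ Λc := by positivity
  have hCP : 0 ≤ CP := by norm_num
  have hα : 0 ≤ a * (n : ℝ) ^ 2 := by positivity
  have hCR : 0 ≤ CR := by positivity
  have hε₁ : 0 ≤ ε₁ := by positivity
  have hδ' : 0 ≤ δ' := by positivity
  have hetil : 0 ≤ (ε₁ * CR + 2 * δ' * Real.sqrt ((1 + ε₁ * CR) * CP) + δ' ^ 2 * CP) * (Λc + 1) := by positivity
  have hΛ : 0 ≤ Λ := add_nonneg hΛc hetil
  have hT1 : ∀ x, ‖T x‖ ≤ 1 := fun x => norm_le_one_of_mem_unitary (hT x)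
  have hR'1 : ∀ x μ, ‖R' x μ‖ ≤ 1 := fun x μ => norm_le_one_of_mem_unitary (hR' x μ)
  -- the scalar classes from data (verbatim `colour_pair_closed_local`)
  have hUBc0 : ∀ ν : Tor M → E, ∃ f, Qkv n M T f = ν ∧ Scv n M Rc f ≤ Λc * nsqv ν :=
    hUBc_colour_rel n M hT₀ hRc hw0 hw₀ hγ hrel hw'
  have hPc : ∀ f, qWv n M f ≤ CP * (Scv n M Rc f + nsqv (Qkv n M T f)) := fun f => qWv_le_coarse_rel n M hT₀ hw₀ hrel hsmall f
  have hPf : ∀ f', qVv n L M f' ≤ CP * (Sfv n L M R' f' + nsqv (Qkv n M T (Q1v n L M T' f'))) := fun f' =>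
    qVv_le_composite_rel n L M hT₀ hw₀ hrel hsmall hT' hw₁ hsmall₁ hR'1 hm hmis habsorb f'
  have hONE : ∀ f, blockSpin (Q1v n L M T') (Sfv n L M R') f
      ≤ (Real.sqrt (Scv n M Rc f + ε₁ * rhov n M Rc f) + δ' * Real.sqrt (qWv n M f)) ^ 2 := fun f =>
    blockSpin_Q1v_le n L M hT' hRc hm₁ hin hcross f
  have hREG : ∀ (ν : Tor M → E) f, Qkv n M T f = ν → (∀ f₂, Qkv n M T f₂ = ν → Scv n M Rc f ≤ Scv n M Rc f₂) →
      rhov n M Rc f ≤ CR * (Scv n M Rc f + nsqv ν) := hREG_rhov n M hT hRc ha hP hΛc hUBc0 hPc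
  have hnLd : (0 : ℝ) ≤ ((n : ℝ) * L) ^ d := by positivity
  have hnormW : ∀ f : Tor (fine n M) → E, ‖f‖ ^ 2 ≤ ((n : ℝ) * L) ^ d * qWv n M f := by
    intro f
    refine (norm_sq_le_qWv n M f).trans (mul_le_mul_of_nonneg_right ?_ (qWv_nonneg n M f))
    rw [mul_pow]
    exact le_mul_of_one_le_right (by positivity) (one_le_pow₀ hL1)
  have hnormV : ∀ f' : Tor (fine L (fine n M)) → E, ‖f'‖ ^ 2 ≤ ((n : ℝ) * L) ^ d * qVv n L M f' := norm_sq_le_qVv n L M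
  have hUBf : ∀ ν : Tor M → E, ∃ f', Qkv n M T (Q1v n L M T' f') = ν ∧ Sfv n L M R' f' ≤ Λ * nsqv ν := by
    intro ν
    exact fine_ub_of_coarse_sqrt (V := Tor (fine L (fine n M)) → E) (W := Tor (fine n M) → E) (Z := Tor M → E)
      (Qk := Qkv n M T) (Q₁ := Q1v n L M T') (Sc := Scv n M Rc) (Sf := Sfv n L M R') (qW := qWv n M) (qV := qVv n L M) (qZ := nsqv)
      (ρ := rhov n M Rc) (continuous_Qcv T) (continuous_Qcv T') (continuous_sum_dirUv Rc _) (continuous_sum_dirUv R' _)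
      (Q1v_surjective n L M T' hT') (Scv_nonneg n M Rc) (Sfv_nonneg n L M R') (qWv_nonneg n M) (fun μ => nsqv_nonneg μ)
      (rhov_nonneg n M Rc) hnLd hnLd hΛc hCP hCR hε₁ hδ' hnormW hnormV hUBc0 hPc hPf hONE hREG ν
  have hUBc : ∀ ν : Tor M → E, ∃ f, Qkv n M T f = ν ∧ Scv n M Rc f ≤ Λ * nsqv ν := by
    intro ν
    obtain ⟨f, hf, hb⟩ := hUBc0 ν
    exact ⟨f, hf, hb.trans (mul_le_mul_of_nonneg_right (le_add_of_nonneg_right hetil) (nsqv_nonneg ν))⟩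
  -- DIV-AVG with background (file 8) at the pair `(Q_{lineT T′ R′} g, g)`
  have hεD : 0 ≤ εD := by positivity
  have hρD : 0 ≤ ρD := by
    have hH : 0 ≤ hessV (fine L (fine n M)) R' g := by unfold hessV; exact sum_nonneg fun ν _ => hessv_nonneg _ _ _
    have hQ : 0 ≤ qVV n L M g := qVV_nonneg n L M g
    positivity
  have hDIV := divAvg_cov L n M hRc hR' hT' hm hmis g
  exact avgG_projG_of_divAvg n L M hT1 hT' hRc hR'1 hm hmis hm₁ hin hcross hΛ hCP hCR hUBc hUBf hPc hPf hREG
    (QvL L (fine n M) (lineT L (fine n M) T' R') g) g hεD hρD hDIV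

end Summit.QuantumFields.BalabanUV.T4Continuum.VariationalVectorAvgGProjGData

end
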